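import Summits.AtomisticToContinuum.HydrodynamicLimit.Theorems.LambertianContactSwapLambertianEulerSecondMoment
import Summits.AtomisticToContinuum.HydrodynamicLimit.Theorems.LambertianContactSwapLambertianEulerLambertDirMean
import HarnessLib

/-!
# Conditional second moments of the Lambertian redraw (crux `LambertianEuler`, stmt-AtomisticToContinuum-11854, line `Sketch`, stub `stub_lambertPairMeanSq`)

Registered stub `stub_lambertPairMeanSq` of the lead skeleton (`Cruxes/LambertianEuler/Lines/Sketch.lean`,
§2b): the second moments, about an arbitrary centre `a ∈ ℝ³`, of the two outgoing velocities of a pair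
`(i, j)` redrawn with the Lambert cosine law (`lambertPair`,
`Literature.MathematicalPhysics.KineticTheory.LambertianHardSphereFlow`).

With `ω := G.sepVec xᵢ xⱼ ≠ 0`, `ω̂ := ω/‖ω‖`, `c := (vᵢ + vⱼ)/2`, `g := vᵢ - vⱼ` and
`n' := lambertDir ω ξ` (`ξ` standard Gaussian in `ℝ³`), the redrawn velocities are
`vᵢ' = c + (‖g‖/2) n'`, `vⱼ' = c - (‖g‖/2) n'`, and

* `E‖vᵢ' - a‖² = ‖c - a‖² + ‖g‖²/4 + (2/3) ‖g‖ ⟪ω̂, c - a⟫`,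
* `E‖vⱼ' - a‖² = ‖c - a‖² + ‖g‖²/4 - (2/3) ‖g‖ ⟪ω̂, c - a⟫`,

GIVEN the mean of the cosine law `E[n'] = (2/3) ω̂` (the hypothesis; it is the sibling stub
`stub_lambertDirMean`, landed in `…LambertianEulerLambertDirMean`).

## Proof

Pointwise `vᵢ' - a = (c - a) + s • n'` with `s = ‖g‖/2` (resp. `s = -‖g‖/2` for `j`), so
`‖vᵢ' - a‖² = ‖c - a‖² + 2 s ⟪c - a, n'⟫ + s² ‖n'‖²` (`norm_add_sq_real`); almost surely `‖n'‖ = 1`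
(`ae_stdGaussian_lambertDir_ne_zero_euclideanSpace`, `norm_lambertDir`), so the integrand is a.e.
the affine function `(‖c - a‖² + s²) + 2 s ⟪c - a, n'⟫` of `n'`; integrating against the probability
measure `stdGaussian V3` (`integral_const`, `integral_const_mul`, `integral_inner` with
`integrable_lambertDir`) and inserting the hypothesis gives
`‖c - a‖² + s² + 2 s (2/3) ⟪ω̂, c - a⟫` (`integral_norm_add_smul_lambertDir_sub_sq`), which is the
claim for `s = ± ‖g‖/2`.

References: J. H. Lambert, *Photometria* (1760) (cosine law); F. Comets, S. Popov, G. M. Schütz,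
M. Vachkovskaia, *Billiards in a general domain with random reflections*, Arch. Ration. Mech. Anal.
191 (2009) §2.1 (the Knudsen/Lambert reflection kernel); all statements here [folklore].
-/

noncomputable section

namespace Summit.AtomisticToContinuum.HydrodynamicLimit.Theorems.LambertianContactSwapLambertianEulerPairMeanSq

open scoped BigOperators Topology ENNReal InnerProductSpace
open MeasureTheory ProbabilityTheory Filter Set InformationTheory
open Literature.MathematicalPhysics.KineticTheory
open Literature.Analysis.FluidPDE Literature.Analysis.FluidPDE.Alexander
open Summit.AtomisticToContinuum.HydrodynamicLimit.Theorems.LambertianContactSwapLambertianEulerLambertDirMean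

/-! ### The second moment of an affine image of the Lambertian direction -/

/-- Almost surely (standard Gaussian noise) the squared distance from `a` of the affine image
`c + s • lambertDir ω ξ` is the affine function `(‖c - a‖² + s²) + 2 s ⟪c - a, lambertDir ω ξ⟫` of the
direction, because `‖lambertDir ω ξ‖ = 1` almost surely. [folklore] -/
theorem norm_add_smul_lambertDir_sub_sq_ae (ω c a : V3) (s : ℝ) :
    (fun ξ : V3 => ‖c + s • lambertDir ω ξ - a‖ ^ 2) =ᵐ[stdGaussian V3]
      fun ξ : V3 => (‖c - a‖ ^ 2 + s ^ 2) + 2 * s * ⟪c - a, lambertDir ω ξ⟫_ℝ := by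
  filter_upwards [ae_stdGaussian_lambertDir_ne_zero_euclideanSpace ω] with ξ h
  rw [add_sub_right_comm, norm_add_sq_real, norm_smul, norm_lambertDir h, mul_one,
    Real.norm_eq_abs, sq_abs, real_inner_smul_right]
  ring

/-- **Second moment of an affine image of the cosine law.** Given the mean
`E[lambertDir ω ξ] = (2/3) ω̂` of the cosine law (hypothesis), for `ω ≠ 0`, every centre `c`, shift `a`
and scalar `s`: `E‖c + s • lambertDir ω ξ - a‖² = ‖c - a‖² + s² + 2 s (2/3) ⟪ω̂, c - a⟫`. [folklore] -/
theorem integral_norm_add_smul_lambertDir_sub_sq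
    (hmean : ∀ ω : V3, ω ≠ 0 → ∫ ξ, lambertDir ω ξ ∂(stdGaussian V3) = (2 / 3 : ℝ) • (‖ω‖⁻¹ • ω))
    {ω : V3} (hω : ω ≠ 0) (c a : V3) (s : ℝ) :
    ∫ ξ, ‖c + s • lambertDir ω ξ - a‖ ^ 2 ∂(stdGaussian V3) =
      ‖c - a‖ ^ 2 + s ^ 2 + 2 * s * (2 / 3) * ⟪‖ω‖⁻¹ • ω, c - a⟫_ℝ := by
  rw [integral_congr_ae (norm_add_smul_lambertDir_sub_sq_ae ω c a s),
    integral_add (integrable_const _) ((integrable_inner_lambertDir ω _).const_mul _),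
    integral_const, integral_const_mul, integral_inner (integrable_lambertDir ω) (c - a),
    hmean ω hω, real_inner_smul_right, real_inner_comm, probReal_univ, one_smul]
  ring

/-! ### The registered stub -/

/-- **Registered stub `stub_lambertPairMeanSq`** (line `Sketch`, crux stmt-AtomisticToContinuum-11854,
skeleton §2b): **conditional second moments of the Lambertian redraw of a pair.** With
`ω := G.sepVec xᵢ xⱼ ≠ 0`, `ω̂ := ω/‖ω‖`, `c := (vᵢ + vⱼ)/2`, `g := vᵢ - vⱼ`, and given the mean of the
cosine law `E[lambertDir ω ξ] = (2/3) ω̂` (hypothesis), the redrawn velocities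
`vᵢ' = c + (‖g‖/2) n'`, `vⱼ' = c - (‖g‖/2) n'` (`n' = lambertDir ω ξ`, `ξ` standard Gaussian) satisfy
`E‖vᵢ' - a‖² = ‖c - a‖² + ‖g‖²/4 + (2/3)‖g‖⟪ω̂, c - a⟫` and
`E‖vⱼ' - a‖² = ‖c - a‖² + ‖g‖²/4 - (2/3)‖g‖⟪ω̂, c - a⟫` for every `a ∈ ℝ³`
(expand the square, `‖n'‖ = 1` a.s., and `E⟪c - a, n'⟫ = ⟪c - a, E n'⟫`). [folklore] -/
theorem stub_lambertPairMeanSq :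
    (∀ ω : V3, ω ≠ 0 → ∫ ξ, lambertDir ω ξ ∂(stdGaussian V3) = (2 / 3 : ℝ) • (‖ω‖⁻¹ • ω)) →
    ∀ (N : ℕ) (G : Geometry (Fin 3) T3) (i j : Fin N), i ≠ j →
      ∀ z : Config N (Fin 3) T3, G.sepVec (z i).1 (z j).1 ≠ 0 → ∀ a : V3,
        ∫ ξ, ‖(lambertPair G i j z ξ i).2 - a‖ ^ 2 ∂(stdGaussian V3) =
            ‖(2 : ℝ)⁻¹ • ((z i).2 + (z j).2) - a‖ ^ 2 + ‖(z i).2 - (z j).2‖ ^ 2 / 4 +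
              2 / 3 * ‖(z i).2 - (z j).2‖ *
                ⟪‖G.sepVec (z i).1 (z j).1‖⁻¹ • G.sepVec (z i).1 (z j).1, (2 : ℝ)⁻¹ • ((z i).2 + (z j).2) - a⟫_ℝ ∧
          ∫ ξ, ‖(lambertPair G i j z ξ j).2 - a‖ ^ 2 ∂(stdGaussian V3) =
            ‖(2 : ℝ)⁻¹ • ((z i).2 + (z j).2) - a‖ ^ 2 + ‖(z i).2 - (z j).2‖ ^ 2 / 4 -
              2 / 3 * ‖(z i).2 - (z j).2‖ *
                ⟪‖G.sepVec (z i).1 (z j).1‖⁻¹ • G.sepVec (z i).1 (z j).1, (2 : ℝ)⁻¹ • ((z i).2 + (z j).2) - a⟫_ℝ := by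
  intro hmean N G i j hij z hω a
  have hl : ∀ ξ : V3, (lambertPair G i j z ξ i).2 = (2 : ℝ)⁻¹ • ((z i).2 + (z j).2) +
      (‖(z i).2 - (z j).2‖ / 2) • lambertDir (G.sepVec (z i).1 (z j).1) ξ := fun ξ => by
    rw [lambertPair_apply_left hij]
  have hr : ∀ ξ : V3, (lambertPair G i j z ξ j).2 = (2 : ℝ)⁻¹ • ((z i).2 + (z j).2) +
      (-(‖(z i).2 - (z j).2‖ / 2)) • lambertDir (G.sepVec (z i).1 (z j).1) ξ := fun ξ => by
    rw [lambertPair_apply_right, neg_smul, ← sub_eq_add_neg]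
  simp_rw [hl, hr]
  refine ⟨?_, ?_⟩
  · rw [integral_norm_add_smul_lambertDir_sub_sq hmean hω]
    ring
  · rw [integral_norm_add_smul_lambertDir_sub_sq hmean hω]
    ring

end Summit.AtomisticToContinuum.HydrodynamicLimit.Theorems.LambertianContactSwapLambertianEulerPairMeanSq

end
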